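import Summits.QuantumFields.QCD.Theses.SpectralDefectExtinction
import Summits.QuantumFields.QCD.Theses.GradientFlowSpecies
import Summits.QuantumFields.QCD.Theorems.RobustYangMillsHandover.Negative.ChiralityObstruction

/-!
# Crux `ChiralDescent` (stmt-QuantumFields-17527, route SpectralDefectExtinction) — ideator 1, round 1

Sketch file for two crux idea cards (crux-ideate; NO skeleton, only the first checkable lemmas):

* §1 `Body`, `goodOffsets`, `shiftReg` — the FULL-BODY up-set of the hypothesis' own regularisation
  (for this crux nothing — neither lattice gaps nor continuum data — is given below the threshold `M₁`,
  so the up-set must be cut on the full per-tuple body, not on lattice gaps as in the sibling crux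
  `RobustYangMillsHandover`'s `gappedOffsets`).
* §2 card `theta-pi-anchor`: `FullBodyOpenness`, `HasBadTuple`, the PROVED reduction
  `qcdOf_of_openness_of_badTuple` / `chiralDescent_of_openness_and_badTuple`, and the PROVED anchor lemma
  `not_hasLatticeMassGap_of_lro` (long-range order of one local observable on the scheme's tori kills every
  lattice rate) — the typed form of "a CP-coexistence (θ = π) tuple is a bad tuple".
* §3 card `affine-pcac-continuum-limit`: `ContinuumChiralAt`, the PROVED transfer
  `isChiralAtZero_shift_of_continuumChiral` (through the tree item `GradientFlowSpecies.GapTransfer` BY NAME)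
  and the PROVED reduction `qcdOf_of_continuumChiral` / `chiralDescent_of_continuumChiral`.

Pure logic over the tree's definitions; imports only route modules and the landed
`Theorems/RobustYangMillsHandover/Negative/ChiralityObstruction`.
-/

namespace Summit.QuantumFields.QCD.Cruxes.ChiralDescent.Ideator1

open Filter Topology
open Literature.MathematicalPhysics.QuantumFieldTheory
open Summit.QuantumFields.QCD.Theorems.RobustYangMillsHandover.Negative

variable {Nf : ℕ}

/-! ## §1 The full-body up-set of the hypothesis' regularisation -/

/-- The per-tuple BODY of the (re-typed) conjunct along `reg` at the offset tuple `t` (any signs). -/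
def Body (reg : QCDRegularisation Nf) (t : Fin Nf → ℝ) : Prop :=
  ∃ (z shift : QCDField Nf → ℕ → ℝ) (T : OSData (QCDField Nf) 4),
    IsQCDAlong (reg.scheme t z shift) T ∧ T.IsNontrivial QCDField.glue ∧ T.IsNonGaussian QCDField.glue ∧
      (∀ f g : Fin Nf, f ≠ g → T.IsNontrivial (QCDField.pseudoRe f g)) ∧
        ∃ Δ > 0, T.HasMassGap Δ ∧ (reg.scheme t z shift).HasLatticeMassGap Δ

/-- GOOD OFFSETS: `M` is good iff every tuple strictly above `M` (componentwise) carries the full body.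
An up-set of `ℝ`; the crux's hypothesis says exactly `M₁ ∈ goodOffsets reg`. -/
def goodOffsets (reg : QCDRegularisation Nf) : Set ℝ :=
  {M | ∀ t : Fin Nf → ℝ, (∀ f, M < t f) → Body reg t}

/-- The `m_crit`-shifted regularisation (masses `m` of the shifted one are offsets `M + m` of `reg`). -/
noncomputable def shiftReg (reg : QCDRegularisation Nf) (M : ℝ) : QCDRegularisation Nf :=
  { reg with mcrit := fun k => reg.mcrit k + reg.a k * M / reg.Zm k }

theorem shiftReg_scheme (reg : QCDRegularisation Nf) (M : ℝ) (m : Fin Nf → ℝ)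
    (z shift : QCDField Nf → ℕ → ℝ) :
    (shiftReg reg M).scheme m z shift = reg.scheme (fun f => M + m f) z shift := by
  simp only [shiftReg, QCDRegularisation.scheme, QCDScheme.mk.injEq, true_and, and_true]
  funext f k
  ring

theorem shiftReg_hasMassScaling_iff (reg : QCDRegularisation Nf) (M : ℝ) :
    (shiftReg reg M).HasMassScaling ↔ reg.HasMassScaling :=
  Iff.rfl

theorem body_shiftReg_iff (reg : QCDRegularisation Nf) (M : ℝ) (m : Fin Nf → ℝ) :
    Body (shiftReg reg M) m ↔ Body reg (fun f => M + m f) := by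
  unfold Body
  simp only [shiftReg_scheme]

theorem goodOffsets_mono (reg : QCDRegularisation Nf) {M M' : ℝ} (h : M ≤ M')
    (hM : M ∈ goodOffsets reg) : M' ∈ goodOffsets reg :=
  fun t ht => hM t fun f => lt_of_le_of_lt h (ht f)

/-- The hypothesis of the crux at `N_f` puts its threshold into the good up-set. -/
theorem goodOffsets_nonempty_of_threshold (reg : QCDRegularisation Nf) (M₁ : ℝ)
    (h : ∀ m : Fin Nf → ℝ, (∀ f, M₁ < m f) →
      ∃ (z shift : QCDField Nf → ℕ → ℝ) (T : OSData (QCDField Nf) 4),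
        IsQCDAlong (reg.scheme m z shift) T ∧ T.IsNontrivial QCDField.glue ∧
          T.IsNonGaussian QCDField.glue ∧
            (∀ f g : Fin Nf, f ≠ g → T.IsNontrivial (QCDField.pseudoRe f g)) ∧
              ∃ Δ > 0, T.HasMassGap Δ ∧ (reg.scheme m z shift).HasLatticeMassGap Δ) :
    M₁ ∈ goodOffsets reg :=
  fun t ht => h t ht

/-! ## §2 Card `theta-pi-anchor`: openness of the good region + ONE bad tuple -/

/-- FULL-BODY OPENNESS (the regularity principle, stated at EVERY good offset — so it is not the goal
reworded: it forbids the body to stop dead at a uniformly gapped endpoint ANYWHERE on the offset axis). -/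
def FullBodyOpenness (reg : QCDRegularisation Nf) : Prop :=
  ∀ M : ℝ, M ∈ goodOffsets reg →
    (∃ ε > (0 : ℝ), ∀ t : Fin Nf → ℝ, (∀ f, M < t f) → (reg.scheme t 0 0).HasLatticeMassGap ε) →
      ∃ M' < M, M' ∈ goodOffsets reg

/-- ONE bad tuple: some real offset tuple (any signs) at which the body fails. -/
def HasBadTuple (reg : QCDRegularisation Nf) : Prop :=
  ∃ t : Fin Nf → ℝ, ¬ Body reg t

/-- A bad tuple bounds the good up-set from below. -/
theorem bddBelow_goodOffsets_of_badTuple (reg : QCDRegularisation Nf) (h : HasBadTuple reg) :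
    BddBelow (goodOffsets reg) := by
  obtain ⟨t, ht⟩ := h
  refine ⟨-∑ f, |t f|, fun M hM => ?_⟩
  by_contra hlt
  push Not at hlt
  refine ht (hM t fun f => lt_of_lt_of_le hlt ?_)
  have h1 : -|t f| ≤ t f := neg_abs_le (t f)
  have h2 : |t f| ≤ ∑ g, |t g| :=
    Finset.single_le_sum (f := fun g => |t g|) (fun g _ => abs_nonneg (t g)) (Finset.mem_univ f)
  linarith

/-- Above the infimum of a non-empty, bounded-below good up-set every tuple carries the body. -/
theorem body_of_gt_csInf (reg : QCDRegularisation Nf) (hne : (goodOffsets reg).Nonempty)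
    (_hbdd : BddBelow (goodOffsets reg)) (t : Fin Nf → ℝ) (ht : ∀ f, sInf (goodOffsets reg) < t f) :
    Body reg t := by
  classical
  by_cases hN : (Finset.univ : Finset (Fin Nf)).Nonempty
  · obtain ⟨f₀, -, hf₀⟩ := Finset.exists_min_image Finset.univ t hN
    obtain ⟨M, hM, hMlt⟩ := exists_lt_of_csInf_lt hne (ht f₀)
    exact hM t fun f => lt_of_lt_of_le hMlt (hf₀ f (Finset.mem_univ f))
  · obtain ⟨M, hM⟩ := hne
    exact hM t fun f => absurd ⟨f, Finset.mem_univ f⟩ hN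

/-- The infimum of the good up-set is itself good. -/
theorem csInf_mem_goodOffsets (reg : QCDRegularisation Nf) (hne : (goodOffsets reg).Nonempty)
    (hbdd : BddBelow (goodOffsets reg)) : sInf (goodOffsets reg) ∈ goodOffsets reg :=
  fun t ht => body_of_gt_csInf reg hne hbdd t ht

/-- **The pin is chiral iff the good region is open at it** — and openness makes it so: the
regularisation shifted to the infimum of the good up-set is chiral at zero. -/
theorem isChiralAtZero_shift_csInf (reg : QCDRegularisation Nf) (hne : (goodOffsets reg).Nonempty)
    (hbdd : BddBelow (goodOffsets reg)) (hopen : FullBodyOpenness reg) :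
    (shiftReg reg (sInf (goodOffsets reg))).IsChiralAtZero := by
  set P := sInf (goodOffsets reg) with hP
  change ({ reg with mcrit := fun k => reg.mcrit k + reg.a k * P / reg.Zm k } :
    QCDRegularisation Nf).IsChiralAtZero
  rw [isChiralAtZero_mcrit_shift_iff]
  by_contra hnot
  push Not at hnot
  obtain ⟨ε, hε, hgap⟩ := hnot
  have huni : ∀ t : Fin Nf → ℝ, (∀ f, P < t f) → (reg.scheme t 0 0).HasLatticeMassGap ε := by
    intro t ht
    have h := hgap (fun f => t f - P) (fun f => sub_pos.mpr (ht f))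
    have : (fun f => P + (t f - P)) = t := funext fun f => by ring
    simpa [this] using h
  obtain ⟨M', hM'lt, hM'⟩ := hopen P (csInf_mem_goodOffsets reg hne hbdd) ⟨ε, hε, huni⟩
  exact absurd (csInf_le hbdd hM') (not_le.mpr hM'lt)

/-- **Reduction for card `theta-pi-anchor`**: a non-empty good up-set (the crux's hypothesis), ONE bad
tuple and full-body openness give a witness of the re-typed conjunct — the shift to the infimum. -/
theorem qcdOf_of_openness_of_badTuple (reg : QCDRegularisation Nf) (hMS : reg.HasMassScaling)
    (hne : (goodOffsets reg).Nonempty) (hbad : HasBadTuple reg) (hopen : FullBodyOpenness reg) :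
    QCDOf Nf := by
  have hbdd := bddBelow_goodOffsets_of_badTuple reg hbad
  refine ⟨shiftReg reg (sInf (goodOffsets reg)), (shiftReg_hasMassScaling_iff reg _).mpr hMS,
    isChiralAtZero_shift_csInf reg hne hbdd hopen, fun m hm => ?_⟩
  have hb : Body reg (fun f => sInf (goodOffsets reg) + m f) :=
    body_of_gt_csInf reg hne hbdd _ fun f => lt_add_of_pos_right _ (hm f)
  exact (body_shiftReg_iff reg _ m).mpr hb

/-- **The crux from the two inputs of card `theta-pi-anchor`** (per `N_f ∈ {2,3}`, for every mass-scaling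
regularisation whose good up-set is non-empty: one bad tuple and full-body openness). The flavour guard is
where `HasBadTuple` must be paid (`Negative/FlavourGuard`: at `N_f = 0` it is false given the threshold). -/
theorem chiralDescent_of_openness_and_badTuple
    (h : ∀ Nf : ℕ, (Nf = 2 ∨ Nf = 3) → ∀ reg : QCDRegularisation Nf, reg.HasMassScaling →
      (goodOffsets reg).Nonempty → HasBadTuple reg ∧ FullBodyOpenness reg) :
    Summit.QuantumFields.QCD.Theses.SpectralDefectExtinction.ChiralDescent := by
  intro Nf hNf hth
  obtain ⟨reg, hMS, M₁, -, hbody⟩ := hth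
  have hne : (goodOffsets reg).Nonempty := ⟨M₁, goodOffsets_nonempty_of_threshold reg M₁ hbody⟩
  obtain ⟨hbad, hopen⟩ := h Nf hNf reg hMS hne
  exact qcdOf_of_openness_of_badTuple reg hMS hne hbad hopen

/-- **Anchor lemma (typed form of "a CP-coexistence tuple is bad"): long-range order of ONE gauge-invariant
local lattice observable on tori beyond the scheme's kills EVERY uniform lattice rate.**  If, frequently in
`k`, some torus of side `2S+1 ≥ 2L_k+1` has the antipodal connected autocorrelation of `A` at least `c > 0`,
then `sch` has no lattice gap at any rate `ε > 0` (because `a_k S ≥ a_k L_k → ∞`). -/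
theorem not_hasLatticeMassGap_of_lro (sch : QCDScheme Nf) {R : ℕ} (A : QCDLatticeObservable Nf R)
    {c : ℝ} (hc : 0 < c)
    (hlro : ∃ᶠ k in atTop, ∃ S : ℕ, sch.L k ≤ S ∧
      c ≤ ‖qcdLatticeConnectedCorr (sch.β k) (2 * S + 1) (fun fl => sch.mq fl k) A A S‖) :
    ∀ ε > (0 : ℝ), ¬ sch.HasLatticeMassGap ε := by
  intro ε hε hgap
  obtain ⟨C, hC⟩ := hgap R R A A
  -- eventually `C · exp(−ε a_k L_k) < c`, since `a_k L_k → ∞`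
  have hsmall : ∀ᶠ k in atTop, C * Real.exp (-(ε * (sch.a k * sch.L k))) < c := by
    have h1 : Tendsto (fun k => ε * (sch.a k * sch.L k)) atTop atTop :=
      sch.tendsto_L.const_mul_atTop hε
    have h2 : Tendsto (fun k => Real.exp (-(ε * (sch.a k * sch.L k)))) atTop (𝓝 0) :=
      Real.tendsto_exp_neg_atTop_nhds_zero.comp h1
    have h3 : Tendsto (fun k => C * Real.exp (-(ε * (sch.a k * sch.L k)))) atTop (𝓝 (C * 0)) :=
      h2.const_mul C
    rw [mul_zero] at h3
    exact h3.eventually (gt_mem_nhds hc)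
  obtain ⟨k, ⟨S, hS, hcS⟩, hk, hks⟩ := (hlro.and_eventually (hC.and hsmall)).exists
  have hb := hk S hS S le_rfl
  have hmono : C * Real.exp (-(ε * (sch.a k * (S : ℕ)))) ≤ max C 0 * Real.exp (-(ε * (sch.a k * sch.L k))) := by
    have ha : 0 ≤ sch.a k := (sch.a_pos k).le
    have hLS : (sch.L k : ℝ) ≤ (S : ℝ) := by exact_mod_cast hS
    calc C * Real.exp (-(ε * (sch.a k * (S : ℕ))))
        ≤ max C 0 * Real.exp (-(ε * (sch.a k * (S : ℕ)))) :=
          mul_le_mul_of_nonneg_right (le_max_left _ _) (Real.exp_pos _).le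
      _ ≤ max C 0 * Real.exp (-(ε * (sch.a k * sch.L k))) := by
          refine mul_le_mul_of_nonneg_left (Real.exp_le_exp.mpr ?_) (le_max_right _ _)
          have : ε * (sch.a k * sch.L k) ≤ ε * (sch.a k * (S : ℝ)) :=
            mul_le_mul_of_nonneg_left (mul_le_mul_of_nonneg_left hLS ha) hε.le
          linarith
  have hmax : max C 0 * Real.exp (-(ε * (sch.a k * sch.L k))) < c := by
    rcases le_or_gt 0 C with hC0 | hC0
    · rw [max_eq_left hC0]; exact hks
    · rw [max_eq_right hC0.le, zero_mul]; exact hc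
  linarith

/-- **Anchor lemma, fixed-cutoff form (the physically right one: the order parameter in lattice units,
hence the LRO constant `c_k ∼ a_k⁸ ⟨q⟩²`, may vanish as `k → ∞`).**  If, frequently in `k`, there is a
`k`-DEPENDENT `c_k > 0` such that on ARBITRARILY LARGE tori `S ≥ L_k` the antipodal connected autocorrelation
of `A` is at least `c_k` (phase coexistence at cutoff `a_k`), then `sch` has no lattice gap at any rate
`ε > 0` — at fixed `k` the bound `C e^{−ε a_k S}` dies as `S → ∞` while `c_k` stays. -/
theorem not_hasLatticeMassGap_of_lro_fixedCutoff (sch : QCDScheme Nf) {R : ℕ} (A : QCDLatticeObservable Nf R)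
    (hlro : ∃ᶠ k in atTop, ∃ c : ℝ, 0 < c ∧ ∀ S₀ : ℕ, ∃ S : ℕ, S₀ ≤ S ∧ sch.L k ≤ S ∧
      c ≤ ‖qcdLatticeConnectedCorr (sch.β k) (2 * S + 1) (fun fl => sch.mq fl k) A A S‖) :
    ∀ ε > (0 : ℝ), ¬ sch.HasLatticeMassGap ε := by
  intro ε hε hgap
  obtain ⟨C, hC⟩ := hgap R R A A
  obtain ⟨k, ⟨c, hc, hS⟩, hk⟩ := (hlro.and_eventually hC).exists
  -- at fixed `k`: `C · exp(−ε a_k S) → 0` as `S → ∞`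
  have hsmall : ∀ᶠ S : ℕ in atTop, C * Real.exp (-(ε * (sch.a k * (S : ℝ)))) < c := by
    have h1 : Tendsto (fun S : ℕ => ε * (sch.a k * (S : ℝ))) atTop atTop :=
      (tendsto_natCast_atTop_atTop.const_mul_atTop (sch.a_pos k)).const_mul_atTop hε
    have h2 : Tendsto (fun S : ℕ => Real.exp (-(ε * (sch.a k * (S : ℝ))))) atTop (𝓝 0) :=
      Real.tendsto_exp_neg_atTop_nhds_zero.comp h1
    have h3 := h2.const_mul C
    rw [mul_zero] at h3
    exact h3.eventually (gt_mem_nhds hc)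
  obtain ⟨S₀, hS₀⟩ := eventually_atTop.mp hsmall
  obtain ⟨S, hS₀S, hLS, hcS⟩ := hS S₀
  have hb := hk S hLS S le_rfl
  have hlt := hS₀ S hS₀S
  linarith

/-- Corollary: a regularisation and a tuple with (fixed-cutoff) long-range order of one local observable
frequently in `k` are a BAD tuple of `reg` (the body claims some positive lattice rate there). -/
theorem not_body_of_lro (reg : QCDRegularisation Nf) (t : Fin Nf → ℝ) {R : ℕ} (A : QCDLatticeObservable Nf R)
    (hlro : ∃ᶠ k in atTop, ∃ c : ℝ, 0 < c ∧ ∀ S₀ : ℕ, ∃ S : ℕ, S₀ ≤ S ∧ reg.L k ≤ S ∧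
      c ≤ ‖qcdLatticeConnectedCorr (reg.β k) (2 * S + 1)
        (fun fl => reg.mcrit k + reg.a k * t fl / reg.Zm k) A A S‖) :
    ¬ Body reg t := by
  rintro ⟨z, shift, T, -, -, -, -, Δ, hΔ, -, hgap⟩
  exact not_hasLatticeMassGap_of_lro_fixedCutoff (reg.scheme t z shift) A hlro Δ hΔ hgap

/-! ## §3 Card `affine-pcac-continuum-limit`: chirality is decided in the continuum -/

/-- CONTINUUM CHIRALITY just above the offset `P`: for every rate `ε > 0` some tuple strictly above `P`
whose (existing) continuum OS data fail the full-spectrum gap `ε` — a statement about the family of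
continuum theories `T_t` only (the card supplies it from: affine PCAC mass `m_R(t) = κ (t − P)`, compactness
`T_t → T_*` as `t ↓ P`, exact chiral Ward identities of `T_*`, and the 't Hooft anomaly / Coleman–Grossman
no-go for a gapped `T_*`). -/
def ContinuumChiralAt (reg : QCDRegularisation Nf) (P : ℝ) : Prop :=
  ∀ ε > (0 : ℝ), ∃ t : Fin Nf → ℝ, (∀ f, P < t f) ∧
    ∃ (z shift : QCDField Nf → ℕ → ℝ) (T : OSData (QCDField Nf) 4),
      IsQCDAlong (reg.scheme t z shift) T ∧ ¬ T.HasMassGap ε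

/-- **Transfer (proved through the tree item `GradientFlowSpecies.GapTransfer` BY NAME)**: continuum
chirality just above `P` makes the `P`-shifted regularisation chiral at zero — a continuum species
correlator slower than `ε/2` forbids the uniform LATTICE rate `ε` at the same tuple. -/
theorem isChiralAtZero_shift_of_continuumChiral
    (hGT : Summit.QuantumFields.QCD.Theses.GradientFlowSpecies.GapTransfer)
    (reg : QCDRegularisation Nf) (P : ℝ) (hC : ContinuumChiralAt reg P) :
    (shiftReg reg P).IsChiralAtZero := by
  change ({ reg with mcrit := fun k => reg.mcrit k + reg.a k * P / reg.Zm k } :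
    QCDRegularisation Nf).IsChiralAtZero
  rw [isChiralAtZero_mcrit_shift_iff]
  intro ε hε
  obtain ⟨t, ht, z, shift, T, hA, hng⟩ := hC (ε / 2) (half_pos hε)
  refine ⟨fun f => t f - P, fun f => sub_pos.mpr (ht f), fun hgap => hng ?_⟩
  have heq : (fun f => P + (t f - P)) = t := funext fun f => by ring
  rw [heq] at hgap
  have hgap' : (reg.scheme t z shift).HasLatticeMassGap ε :=
    (hasLatticeMassGap_species_irrel reg t z shift ε).mpr hgap
  exact hGT Nf (reg.scheme t z shift) T ε (ε / 2) (half_pos hε) (half_lt_self hε) hA hgap'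

/-- **Reduction for card `affine-pcac-continuum-limit`**: the body at every tuple above the located offset
`P` (the zero of the affine PCAC mass — extension burden, shared), the gap transfer, and continuum
chirality at `P` give the conjunct with the witness `shiftReg reg P`. -/
theorem qcdOf_of_continuumChiral
    (hGT : Summit.QuantumFields.QCD.Theses.GradientFlowSpecies.GapTransfer)
    (reg : QCDRegularisation Nf) (hMS : reg.HasMassScaling) (P : ℝ)
    (hbody : ∀ t : Fin Nf → ℝ, (∀ f, P < t f) → Body reg t) (hC : ContinuumChiralAt reg P) :
    QCDOf Nf := by
  refine ⟨shiftReg reg P, (shiftReg_hasMassScaling_iff reg P).mpr hMS,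
    isChiralAtZero_shift_of_continuumChiral hGT reg P hC, fun m hm => ?_⟩
  exact (body_shiftReg_iff reg P m).mpr (hbody _ fun f => lt_add_of_pos_right _ (hm f))

/-- **The crux from the inputs of card `affine-pcac-continuum-limit`** (per `N_f ∈ {2,3}`: for the
threshold regularisation, SOME offset `P` — the card: the zero of the affine continuum PCAC mass — with the
body above it and continuum chirality at it), given the gap-transfer support item. -/
theorem chiralDescent_of_continuumChiral
    (hGT : Summit.QuantumFields.QCD.Theses.GradientFlowSpecies.GapTransfer)
    (h : ∀ Nf : ℕ, (Nf = 2 ∨ Nf = 3) → ∀ reg : QCDRegularisation Nf, reg.HasMassScaling →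
      (goodOffsets reg).Nonempty →
        ∃ P : ℝ, (∀ t : Fin Nf → ℝ, (∀ f, P < t f) → Body reg t) ∧ ContinuumChiralAt reg P) :
    Summit.QuantumFields.QCD.Theses.SpectralDefectExtinction.ChiralDescent := by
  intro Nf hNf hth
  obtain ⟨reg, hMS, M₁, -, hbody⟩ := hth
  have hne : (goodOffsets reg).Nonempty := ⟨M₁, goodOffsets_nonempty_of_threshold reg M₁ hbody⟩
  obtain ⟨P, hP, hC⟩ := h Nf hNf reg hMS hne
  exact qcdOf_of_continuumChiral hGT reg hMS P hP hC

end Summit.QuantumFields.QCD.Cruxes.ChiralDescent.Ideator1
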